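import Summits.MatrixMultiplication.MatrixMultiplication.Theorems.SoloBlindTriangleQuotHgood

/-!
# The triangle move: shape of the members, I (solo-blind s80)

Setting of `SoloBlindTriangleQuotZsf` (triangle `a b c q1 q2 q3` of 3-term representations of the
H-good `τ` inside the zero-sum-free `S`, exponent 3).  K3.23.15 (iv) of the programme notes
classifies how an arbitrary representation `M ⊆ S` of `τ` can meet the six triangle elements: only
eleven of the 64 patterns survive — the three triples themselves, the private points `{a,b,c}`, the
meeting points `{q1,q2,q3}`, the meeting pair of one triple, or `{a,b,c,q_m}` — every other pattern
being killed by an explicit zero-sum or `(τ+τ)`-sum certificate.  This file: the splitting identity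
`soloBlind_hexad_sum_split`, the predicate `soloBlindTriangleShape` (the eleven patterns), and the
half `a ∈ M` of the classification (`soloBlind_triangle_shape_of_mem`, 32 generated cases); part II
does `a ∉ M` and assembles `soloBlind_triangle_shape`.
-/

namespace Summit.MatrixMultiplication.MatrixMultiplication.Theorems

open Finset

universe u

variable {ι : Type*} [DecidableEq ι]
variable {G : Type u} [AddCommGroup G]

/-- Splitting a sum over `M` along the six (distinct) triangle elements. -/
theorem soloBlind_hexad_sum_split (h : ι → G) (M : Finset ι) {a b c q1 q2 q3 : ι} (d_a_b : a ≠ b)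
    (d_a_c : a ≠ c) (d_a_q1 : a ≠ q1) (d_a_q2 : a ≠ q2) (d_a_q3 : a ≠ q3) (d_b_c : b ≠ c)
    (d_b_q1 : b ≠ q1) (d_b_q2 : b ≠ q2) (d_b_q3 : b ≠ q3) (d_c_q1 : c ≠ q1) (d_c_q2 : c ≠ q2)
    (d_c_q3 : c ≠ q3) (d_q1_q2 : q1 ≠ q2) (d_q1_q3 : q1 ≠ q3) (d_q2_q3 : q2 ≠ q3) :
    ∑ i ∈ M, h i = (if a ∈ M then h a else 0) + (if b ∈ M then h b else 0) +
      (if c ∈ M then h c else 0) + (if q1 ∈ M then h q1 else 0) + (if q2 ∈ M then h q2 else 0) +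
      (if q3 ∈ M then h q3 else 0) + ∑ i ∈ M \ soloBlindHexad a b c q1 q2 q3, h i := by
  have hsplit := Finset.sum_filter_add_sum_filter_not M
    (fun i => i ∈ soloBlindHexad a b c q1 q2 q3) (fun i => h i)
  rw [← Finset.sdiff_eq_filter] at hsplit
  rw [← hsplit, Finset.filter_mem_eq_inter, Finset.inter_comm, ← Finset.filter_mem_eq_inter,
    Finset.sum_filter]
  have e : soloBlindHexad a b c q1 q2 q3 = insert a (insert b (insert c (insert q1 {q2, q3}))) :=
    rfl
  have N1 : a ∉ insert b (insert c (insert q1 ({q2, q3} : Finset ι))) := by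
    simp only [Finset.mem_insert, Finset.mem_singleton, not_or]
    exact ⟨d_a_b, d_a_c, d_a_q1, d_a_q2, d_a_q3⟩
  have N2 : b ∉ insert c (insert q1 ({q2, q3} : Finset ι)) := by
    simp only [Finset.mem_insert, Finset.mem_singleton, not_or]
    exact ⟨d_b_c, d_b_q1, d_b_q2, d_b_q3⟩
  have N3 : c ∉ insert q1 ({q2, q3} : Finset ι) := by
    simp only [Finset.mem_insert, Finset.mem_singleton, not_or]; exact ⟨d_c_q1, d_c_q2, d_c_q3⟩
  have N4 : q1 ∉ ({q2, q3} : Finset ι) := by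
    simp only [Finset.mem_insert, Finset.mem_singleton, not_or]; exact ⟨d_q1_q2, d_q1_q3⟩
  rw [e, Finset.sum_insert N1, Finset.sum_insert N2, Finset.sum_insert N3, Finset.sum_insert N4,
    Finset.sum_pair d_q2_q3]
  abel

/-- The eleven admissible patterns in which a representation `M` of `τ` can meet the triangle
`a b c q1 q2 q3` (K3.23.15 (iv)): the triples `{a,q1,q3}`, `{b,q1,q2}`, `{c,q2,q3}`, the private
points, the meeting points, one meeting pair, or the private points plus one meeting point. -/
def soloBlindTriangleShape (M : Finset ι) (a b c q1 q2 q3 : ι) : Prop :=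
  (a ∈ M ∧ b ∉ M ∧ c ∉ M ∧ q1 ∈ M ∧ q2 ∉ M ∧ q3 ∈ M) ∨
  (a ∉ M ∧ b ∈ M ∧ c ∉ M ∧ q1 ∈ M ∧ q2 ∈ M ∧ q3 ∉ M) ∨
  (a ∉ M ∧ b ∉ M ∧ c ∈ M ∧ q1 ∉ M ∧ q2 ∈ M ∧ q3 ∈ M) ∨
  (a ∈ M ∧ b ∈ M ∧ c ∈ M ∧ q1 ∉ M ∧ q2 ∉ M ∧ q3 ∉ M) ∨
  (a ∉ M ∧ b ∉ M ∧ c ∉ M ∧ q1 ∈ M ∧ q2 ∈ M ∧ q3 ∈ M) ∨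
  (a ∉ M ∧ b ∉ M ∧ c ∉ M ∧ q1 ∈ M ∧ q2 ∈ M ∧ q3 ∉ M) ∨
  (a ∉ M ∧ b ∉ M ∧ c ∉ M ∧ q1 ∉ M ∧ q2 ∈ M ∧ q3 ∈ M) ∨
  (a ∉ M ∧ b ∉ M ∧ c ∉ M ∧ q1 ∈ M ∧ q2 ∉ M ∧ q3 ∈ M) ∨
  (a ∈ M ∧ b ∈ M ∧ c ∈ M ∧ q1 ∈ M ∧ q2 ∉ M ∧ q3 ∉ M) ∨
  (a ∈ M ∧ b ∈ M ∧ c ∈ M ∧ q1 ∉ M ∧ q2 ∈ M ∧ q3 ∉ M) ∨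
  (a ∈ M ∧ b ∈ M ∧ c ∈ M ∧ q1 ∉ M ∧ q2 ∉ M ∧ q3 ∈ M)

set_option maxHeartbeats 1600000 in
/-- Shape classification, half `a ∈ M` (32 generated cases; excluded patterns die by an explicit
certificate). -/
theorem soloBlind_triangle_shape_of_mem (three : ∀ g : G, g + g + g = 0) {h : ι → G}
    {S : Finset ι} (zsf : ∀ T ⊆ S, T.Nonempty → ∑ i ∈ T, h i ≠ 0) {τ : G}
    (hgood : ∀ T ⊆ S, ∑ i ∈ T, h i ≠ τ + τ)
    {a b c q1 q2 q3 : ι} (ha : a ∈ S) (hb : b ∈ S) (hc : c ∈ S) (hq1 : q1 ∈ S) (hq2 : q2 ∈ S)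
    (hq3 : q3 ∈ S) (d_a_b : a ≠ b) (d_a_c : a ≠ c) (d_a_q1 : a ≠ q1) (d_a_q2 : a ≠ q2)
    (d_a_q3 : a ≠ q3) (d_b_c : b ≠ c) (d_b_q1 : b ≠ q1) (d_b_q2 : b ≠ q2) (d_b_q3 : b ≠ q3)
    (d_c_q1 : c ≠ q1) (d_c_q2 : c ≠ q2) (d_c_q3 : c ≠ q3) (d_q1_q2 : q1 ≠ q2) (d_q1_q3 : q1 ≠ q3)
    (d_q2_q3 : q2 ≠ q3)
    (hA : h a + h q1 + h q3 = τ) (hB : h b + h q1 + h q2 = τ) (hC : h c + h q2 + h q3 = τ)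
    {M : Finset ι} (hMS : M ⊆ S) (hM : ∑ i ∈ M, h i = τ) (ma : a ∈ M) :
    soloBlindTriangleShape M a b c q1 q2 q3 := by
  have ha' : h a = τ - h q1 - h q3 := by rw [← hA]; abel
  have hb' : h b = τ - h q1 - h q2 := by rw [← hB]; abel
  have hc' : h c = τ - h q2 - h q3 := by rw [← hC]; abel
  have hins : ∀ y : ι, y ∈ S → ∀ V : Finset ι, V ⊆ S → insert y V ⊆ S :=
    fun y hy V hV => Finset.insert_subset_iff.mpr ⟨hy, hV⟩
  set U := M \ soloBlindHexad a b c q1 q2 q3 with hUdef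
  have hUS : U ⊆ S := fun i hi => hMS (Finset.mem_sdiff.mp hi).1
  have hout : ∀ z ∈ soloBlindHexad a b c q1 q2 q3, z ∉ U := fun z hz hzU =>
    (Finset.mem_sdiff.mp hzU).2 hz
  have haU : a ∉ U := hout a (by simp [soloBlindHexad])
  have hbU : b ∉ U := hout b (by simp [soloBlindHexad])
  have hcU : c ∉ U := hout c (by simp [soloBlindHexad])
  have hq1U : q1 ∉ U := hout q1 (by simp [soloBlindHexad])
  have hq2U : q2 ∉ U := hout q2 (by simp [soloBlindHexad])
  have hq3U : q3 ∉ U := hout q3 (by simp [soloBlindHexad])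
  have hsplit := (soloBlind_hexad_sum_split h M d_a_b d_a_c d_a_q1 d_a_q2 d_a_q3 d_b_c d_b_q1 d_b_q2
    d_b_q3 d_c_q1 d_c_q2 d_c_q3 d_q1_q2 d_q1_q3 d_q2_q3).symm
  rw [hM] at hsplit
  try rw [← hUdef] at hsplit
  unfold soloBlindTriangleShape
  by_cases mb : b ∈ M <;> by_cases mc : c ∈ M <;> by_cases mq1 : q1 ∈ M <;>
    by_cases mq2 : q2 ∈ M <;> by_cases mq3 : q3 ∈ M <;>
    simp only [ma, mb, mc, mq1, mq2, mq3, if_true, if_false, add_zero] at hsplit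
  · have hU : ∑ i ∈ U, h i = τ - (h a + h b + h c + h q1 + h q2 + h q3) := by rw [← hsplit]; abel
    have N1 : a ∉ insert b (insert q1 U) := by
      simp only [Finset.mem_insert, not_or]; exact ⟨d_a_b, d_a_q1, haU⟩
    have N2 : b ∉ insert q1 U := by
      simp only [Finset.mem_insert, not_or]; exact ⟨d_b_q1, hbU⟩
    exact (zsf (insert a (insert b (insert q1 U)))
      (hins _ ha _ (hins _ hb _ (hins _ hq1 _ hUS))) (Finset.insert_nonempty _ _)
      (by rw [Finset.sum_insert N1, Finset.sum_insert N2, Finset.sum_insert hq1U, hU]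
          simp only [ha', hb', hc']
          exact soloBlind_tri_close three τ (h q1) (h q2) (h q3) (0) (0) (0) (0) (by
            (try simp only [zero_smul, add_zero, sub_zero]); abel))).elim
  · have hU : ∑ i ∈ U, h i = τ - (h a + h b + h c + h q1 + h q2) := by rw [← hsplit]; abel
    have N1 : a ∉ insert c U := by
      simp only [Finset.mem_insert, not_or]; exact ⟨d_a_c, haU⟩
    exact (zsf (insert a (insert c U)) (hins _ ha _ (hins _ hc _ hUS)) (Finset.insert_nonempty _ _)
      (by rw [Finset.sum_insert N1, Finset.sum_insert hcU, hU]
          simp only [ha', hb', hc']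
          exact soloBlind_tri_close three τ (h q1) (h q2) (h q3) (0) (0) (0) (0) (by
            (try simp only [zero_smul, add_zero, sub_zero]); abel))).elim
  · have hU : ∑ i ∈ U, h i = τ - (h a + h b + h c + h q1 + h q3) := by rw [← hsplit]; abel
    have N1 : a ∉ insert q2 U := by
      simp only [Finset.mem_insert, not_or]; exact ⟨d_a_q2, haU⟩
    exact (hgood (insert a (insert q2 U)) (hins _ ha _ (hins _ hq2 _ hUS))
      (by rw [Finset.sum_insert N1, Finset.sum_insert hq2U, hU]
          simp only [ha', hb', hc']
          exact soloBlind_tri_close three τ (h q1) (h q2) (h q3) (-1) (0) (1) (0) (by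
            (try simp only [zero_smul, one_smul, add_zero]); abel))).elim
  · (iterate 8 right); left; exact ⟨ma, mb, mc, mq1, mq2, mq3⟩ -- Y = {a,b,c,q1}
  · have hU : ∑ i ∈ U, h i = τ - (h a + h b + h c + h q2 + h q3) := by rw [← hsplit]; abel
    have N1 : a ∉ insert b U := by
      simp only [Finset.mem_insert, not_or]; exact ⟨d_a_b, haU⟩
    exact (zsf (insert a (insert b U)) (hins _ ha _ (hins _ hb _ hUS)) (Finset.insert_nonempty _ _)
      (by rw [Finset.sum_insert N1, Finset.sum_insert hbU, hU]
          simp only [ha', hb', hc']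
          exact soloBlind_tri_close three τ (h q1) (h q2) (h q3) (0) (0) (0) (0) (by
            (try simp only [zero_smul, add_zero, sub_zero]); abel))).elim
  · (iterate 9 right); left; exact ⟨ma, mb, mc, mq1, mq2, mq3⟩ -- Y = {a,b,c,q2}
  · (iterate 10 right); exact ⟨ma, mb, mc, mq1, mq2, mq3⟩ -- Y = {a,b,c,q3}
  · (iterate 3 right); left; exact ⟨ma, mb, mc, mq1, mq2, mq3⟩ -- Y = {a,b,c}
  · have hU : ∑ i ∈ U, h i = τ - (h a + h b + h q1 + h q2 + h q3) := by rw [← hsplit]; abel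
    have N1 : a ∉ insert q3 U := by
      simp only [Finset.mem_insert, not_or]; exact ⟨d_a_q3, haU⟩
    exact (zsf (insert a (insert q3 U))
      (hins _ ha _ (hins _ hq3 _ hUS)) (Finset.insert_nonempty _ _)
      (by rw [Finset.sum_insert N1, Finset.sum_insert hq3U, hU]
          simp only [ha', hb']
          exact soloBlind_tri_close three τ (h q1) (h q2) (h q3) (0) (0) (0) (0) (by
            (try simp only [zero_smul, add_zero, sub_zero]); abel))).elim
  · have hU : ∑ i ∈ U, h i = τ - (h a + h b + h q1 + h q2) := by rw [← hsplit]; abel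
    exact (zsf (insert a U) (hins _ ha _ hUS) (Finset.insert_nonempty _ _)
      (by rw [Finset.sum_insert haU, hU]
          simp only [ha', hb']
          exact soloBlind_tri_close three τ (h q1) (h q2) (h q3) (0) (0) (0) (0) (by
            (try simp only [zero_smul, add_zero, sub_zero]); abel))).elim
  · have hU : ∑ i ∈ U, h i = τ - (h a + h b + h q1 + h q3) := by rw [← hsplit]; abel
    exact (zsf (insert b U) (hins _ hb _ hUS) (Finset.insert_nonempty _ _)
      (by rw [Finset.sum_insert hbU, hU]
          simp only [ha', hb']
          exact soloBlind_tri_close three τ (h q1) (h q2) (h q3) (0) (0) (0) (0) (by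
            (try simp only [zero_smul, add_zero, sub_zero]); abel))).elim
  · have hU : ∑ i ∈ U, h i = τ - (h a + h b + h q1) := by rw [← hsplit]; abel
    have N1 : a ∉ insert b (insert c (insert q1 (insert q2 (insert q3 U)))) := by
      simp only [Finset.mem_insert, not_or]; exact ⟨d_a_b, d_a_c, d_a_q1, d_a_q2, d_a_q3, haU⟩
    have N2 : b ∉ insert c (insert q1 (insert q2 (insert q3 U))) := by
      simp only [Finset.mem_insert, not_or]; exact ⟨d_b_c, d_b_q1, d_b_q2, d_b_q3, hbU⟩
    have N3 : c ∉ insert q1 (insert q2 (insert q3 U)) := by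
      simp only [Finset.mem_insert, not_or]; exact ⟨d_c_q1, d_c_q2, d_c_q3, hcU⟩
    have N4 : q1 ∉ insert q2 (insert q3 U) := by
      simp only [Finset.mem_insert, not_or]; exact ⟨d_q1_q2, d_q1_q3, hq1U⟩
    have N5 : q2 ∉ insert q3 U := by
      simp only [Finset.mem_insert, not_or]; exact ⟨d_q2_q3, hq2U⟩
    exact (hgood (insert a (insert b (insert c (insert q1 (insert q2 (insert q3 U))))))
      (hins _ ha _ (hins _ hb _ (hins _ hc _ (hins _ hq1 _ (hins _ hq2 _ (hins _ hq3 _ hUS))))))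
      (by rw [Finset.sum_insert N1, Finset.sum_insert N2, Finset.sum_insert N3,
            Finset.sum_insert N4, Finset.sum_insert N5, Finset.sum_insert hq3U, hU]
          simp only [ha', hb', hc']
          exact soloBlind_tri_close three τ (h q1) (h q2) (h q3) (0) (0) (0) (0) (by
            (try simp only [zero_smul, add_zero]); abel))).elim
  · have hU : ∑ i ∈ U, h i = τ - (h a + h b + h q2 + h q3) := by rw [← hsplit]; abel
    exact (hgood (insert q1 U) (hins _ hq1 _ hUS)
      (by rw [Finset.sum_insert hq1U, hU]
          simp only [ha', hb']
          exact soloBlind_tri_close three τ (h q1) (h q2) (h q3) (-1) (1) (0) (0) (by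
            (try simp only [zero_smul, one_smul, add_zero]); abel))).elim
  · have hU : ∑ i ∈ U, h i = τ - (h a + h b + h q2) := by rw [← hsplit]; abel
    have N1 : c ∉ insert q1 (insert q2 U) := by
      simp only [Finset.mem_insert, not_or]; exact ⟨d_c_q1, d_c_q2, hcU⟩
    have N2 : q1 ∉ insert q2 U := by
      simp only [Finset.mem_insert, not_or]; exact ⟨d_q1_q2, hq1U⟩
    exact (zsf (insert c (insert q1 (insert q2 U)))
      (hins _ hc _ (hins _ hq1 _ (hins _ hq2 _ hUS))) (Finset.insert_nonempty _ _)
      (by rw [Finset.sum_insert N1, Finset.sum_insert N2, Finset.sum_insert hq2U, hU]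
          simp only [ha', hb', hc']
          exact soloBlind_tri_close three τ (h q1) (h q2) (h q3) (0) (1) (0) (0) (by
            (try simp only [zero_smul, one_smul, add_zero, zero_add, sub_zero]); abel))).elim
  · have hU : ∑ i ∈ U, h i = τ - (h a + h b + h q3) := by rw [← hsplit]; abel
    have N1 : c ∉ insert q1 (insert q3 U) := by
      simp only [Finset.mem_insert, not_or]; exact ⟨d_c_q1, d_c_q3, hcU⟩
    have N2 : q1 ∉ insert q3 U := by
      simp only [Finset.mem_insert, not_or]; exact ⟨d_q1_q3, hq1U⟩
    exact (zsf (insert c (insert q1 (insert q3 U)))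
      (hins _ hc _ (hins _ hq1 _ (hins _ hq3 _ hUS))) (Finset.insert_nonempty _ _)
      (by rw [Finset.sum_insert N1, Finset.sum_insert N2, Finset.sum_insert hq3U, hU]
          simp only [ha', hb', hc']
          exact soloBlind_tri_close three τ (h q1) (h q2) (h q3) (0) (1) (0) (0) (by
            (try simp only [zero_smul, one_smul, add_zero, zero_add, sub_zero]); abel))).elim
  · have hU : ∑ i ∈ U, h i = τ - (h a + h b) := by rw [← hsplit]; abel
    have N1 : c ∉ insert q1 U := by
      simp only [Finset.mem_insert, not_or]; exact ⟨d_c_q1, hcU⟩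
    exact (zsf (insert c (insert q1 U))
      (hins _ hc _ (hins _ hq1 _ hUS)) (Finset.insert_nonempty _ _)
      (by rw [Finset.sum_insert N1, Finset.sum_insert hq1U, hU]
          simp only [ha', hb', hc']
          exact soloBlind_tri_close three τ (h q1) (h q2) (h q3) (0) (1) (0) (0) (by
            (try simp only [zero_smul, one_smul, add_zero, zero_add, sub_zero]); abel))).elim
  · have hU : ∑ i ∈ U, h i = τ - (h a + h c + h q1 + h q2 + h q3) := by rw [← hsplit]; abel
    have N1 : a ∉ insert q1 U := by
      simp only [Finset.mem_insert, not_or]; exact ⟨d_a_q1, haU⟩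
    exact (zsf (insert a (insert q1 U))
      (hins _ ha _ (hins _ hq1 _ hUS)) (Finset.insert_nonempty _ _)
      (by rw [Finset.sum_insert N1, Finset.sum_insert hq1U, hU]
          simp only [ha', hc']
          exact soloBlind_tri_close three τ (h q1) (h q2) (h q3) (0) (0) (0) (0) (by
            (try simp only [zero_smul, add_zero, sub_zero]); abel))).elim
  · have hU : ∑ i ∈ U, h i = τ - (h a + h c + h q1 + h q2) := by rw [← hsplit]; abel
    exact (hgood (insert q3 U) (hins _ hq3 _ hUS)
      (by rw [Finset.sum_insert hq3U, hU]
          simp only [ha', hc']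
          exact soloBlind_tri_close three τ (h q1) (h q2) (h q3) (-1) (0) (0) (1) (by
            (try simp only [zero_smul, one_smul, add_zero]); abel))).elim
  · have hU : ∑ i ∈ U, h i = τ - (h a + h c + h q1 + h q3) := by rw [← hsplit]; abel
    exact (zsf (insert c U) (hins _ hc _ hUS) (Finset.insert_nonempty _ _)
      (by rw [Finset.sum_insert hcU, hU]
          simp only [ha', hc']
          exact soloBlind_tri_close three τ (h q1) (h q2) (h q3) (0) (0) (0) (0) (by
            (try simp only [zero_smul, add_zero, sub_zero]); abel))).elim
  · have hU : ∑ i ∈ U, h i = τ - (h a + h c + h q1) := by rw [← hsplit]; abel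
    have N1 : b ∉ insert q1 (insert q3 U) := by
      simp only [Finset.mem_insert, not_or]; exact ⟨d_b_q1, d_b_q3, hbU⟩
    have N2 : q1 ∉ insert q3 U := by
      simp only [Finset.mem_insert, not_or]; exact ⟨d_q1_q3, hq1U⟩
    exact (zsf (insert b (insert q1 (insert q3 U)))
      (hins _ hb _ (hins _ hq1 _ (hins _ hq3 _ hUS))) (Finset.insert_nonempty _ _)
      (by rw [Finset.sum_insert N1, Finset.sum_insert N2, Finset.sum_insert hq3U, hU]
          simp only [ha', hb', hc']
          exact soloBlind_tri_close three τ (h q1) (h q2) (h q3) (0) (0) (0) (1) (by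
            (try simp only [zero_smul, one_smul, add_zero, zero_add, sub_zero]); abel))).elim
  · have hU : ∑ i ∈ U, h i = τ - (h a + h c + h q2 + h q3) := by rw [← hsplit]; abel
    exact (zsf (insert a U) (hins _ ha _ hUS) (Finset.insert_nonempty _ _)
      (by rw [Finset.sum_insert haU, hU]
          simp only [ha', hc']
          exact soloBlind_tri_close three τ (h q1) (h q2) (h q3) (0) (0) (0) (0) (by
            (try simp only [zero_smul, add_zero, sub_zero]); abel))).elim
  · have hU : ∑ i ∈ U, h i = τ - (h a + h c + h q2) := by rw [← hsplit]; abel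
    have N1 : b ∉ insert q2 (insert q3 U) := by
      simp only [Finset.mem_insert, not_or]; exact ⟨d_b_q2, d_b_q3, hbU⟩
    have N2 : q2 ∉ insert q3 U := by
      simp only [Finset.mem_insert, not_or]; exact ⟨d_q2_q3, hq2U⟩
    exact (zsf (insert b (insert q2 (insert q3 U)))
      (hins _ hb _ (hins _ hq2 _ (hins _ hq3 _ hUS))) (Finset.insert_nonempty _ _)
      (by rw [Finset.sum_insert N1, Finset.sum_insert N2, Finset.sum_insert hq3U, hU]
          simp only [ha', hb', hc']
          exact soloBlind_tri_close three τ (h q1) (h q2) (h q3) (0) (0) (0) (1) (by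
            (try simp only [zero_smul, one_smul, add_zero, zero_add, sub_zero]); abel))).elim
  · have hU : ∑ i ∈ U, h i = τ - (h a + h c + h q3) := by rw [← hsplit]; abel
    have N1 : a ∉ insert b (insert c (insert q1 (insert q2 (insert q3 U)))) := by
      simp only [Finset.mem_insert, not_or]; exact ⟨d_a_b, d_a_c, d_a_q1, d_a_q2, d_a_q3, haU⟩
    have N2 : b ∉ insert c (insert q1 (insert q2 (insert q3 U))) := by
      simp only [Finset.mem_insert, not_or]; exact ⟨d_b_c, d_b_q1, d_b_q2, d_b_q3, hbU⟩
    have N3 : c ∉ insert q1 (insert q2 (insert q3 U)) := by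
      simp only [Finset.mem_insert, not_or]; exact ⟨d_c_q1, d_c_q2, d_c_q3, hcU⟩
    have N4 : q1 ∉ insert q2 (insert q3 U) := by
      simp only [Finset.mem_insert, not_or]; exact ⟨d_q1_q2, d_q1_q3, hq1U⟩
    have N5 : q2 ∉ insert q3 U := by
      simp only [Finset.mem_insert, not_or]; exact ⟨d_q2_q3, hq2U⟩
    exact (hgood (insert a (insert b (insert c (insert q1 (insert q2 (insert q3 U))))))
      (hins _ ha _ (hins _ hb _ (hins _ hc _ (hins _ hq1 _ (hins _ hq2 _ (hins _ hq3 _ hUS))))))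
      (by rw [Finset.sum_insert N1, Finset.sum_insert N2, Finset.sum_insert N3,
            Finset.sum_insert N4, Finset.sum_insert N5, Finset.sum_insert hq3U, hU]
          simp only [ha', hb', hc']
          exact soloBlind_tri_close three τ (h q1) (h q2) (h q3) (0) (0) (0) (0) (by
            (try simp only [zero_smul, add_zero]); abel))).elim
  · have hU : ∑ i ∈ U, h i = τ - (h a + h c) := by rw [← hsplit]; abel
    have N1 : b ∉ insert q3 U := by
      simp only [Finset.mem_insert, not_or]; exact ⟨d_b_q3, hbU⟩
    exact (zsf (insert b (insert q3 U))
      (hins _ hb _ (hins _ hq3 _ hUS)) (Finset.insert_nonempty _ _)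
      (by rw [Finset.sum_insert N1, Finset.sum_insert hq3U, hU]
          simp only [ha', hb', hc']
          exact soloBlind_tri_close three τ (h q1) (h q2) (h q3) (0) (0) (0) (1) (by
            (try simp only [zero_smul, one_smul, add_zero, zero_add, sub_zero]); abel))).elim
  · have hU : ∑ i ∈ U, h i = τ - (h a + h q1 + h q2 + h q3) := by rw [← hsplit]; abel
    exact (zsf (insert q2 U) (hins _ hq2 _ hUS) (Finset.insert_nonempty _ _)
      (by rw [Finset.sum_insert hq2U, hU]
          simp only [ha']
          exact soloBlind_tri_close three τ (h q1) (h q2) (h q3) (0) (0) (0) (0) (by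
            (try simp only [zero_smul, add_zero, sub_zero]); abel))).elim
  · have hU : ∑ i ∈ U, h i = τ - (h a + h q1 + h q2) := by rw [← hsplit]; abel
    have N1 : b ∉ insert c (insert q1 U) := by
      simp only [Finset.mem_insert, not_or]; exact ⟨d_b_c, d_b_q1, hbU⟩
    have N2 : c ∉ insert q1 U := by
      simp only [Finset.mem_insert, not_or]; exact ⟨d_c_q1, hcU⟩
    exact (hgood (insert b (insert c (insert q1 U))) (hins _ hb _ (hins _ hc _ (hins _ hq1 _ hUS)))
      (by rw [Finset.sum_insert N1, Finset.sum_insert N2, Finset.sum_insert hq1U, hU]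
          simp only [ha', hb', hc']
          exact soloBlind_tri_close three τ (h q1) (h q2) (h q3) (0) (0) (-1) (0) (by
            (try simp only [zero_smul, add_zero, zero_add]); abel))).elim
  · left; exact ⟨ma, mb, mc, mq1, mq2, mq3⟩ -- Y = {a,q1,q3}
  · have hU : ∑ i ∈ U, h i = τ - (h a + h q1) := by rw [← hsplit]; abel
    have N1 : a ∉ insert c (insert q1 (insert q2 (insert q3 U))) := by
      simp only [Finset.mem_insert, not_or]; exact ⟨d_a_c, d_a_q1, d_a_q2, d_a_q3, haU⟩
    have N2 : c ∉ insert q1 (insert q2 (insert q3 U)) := by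
      simp only [Finset.mem_insert, not_or]; exact ⟨d_c_q1, d_c_q2, d_c_q3, hcU⟩
    have N3 : q1 ∉ insert q2 (insert q3 U) := by
      simp only [Finset.mem_insert, not_or]; exact ⟨d_q1_q2, d_q1_q3, hq1U⟩
    have N4 : q2 ∉ insert q3 U := by
      simp only [Finset.mem_insert, not_or]; exact ⟨d_q2_q3, hq2U⟩
    exact (hgood (insert a (insert c (insert q1 (insert q2 (insert q3 U)))))
      (hins _ ha _ (hins _ hc _ (hins _ hq1 _ (hins _ hq2 _ (hins _ hq3 _ hUS)))))
      (by rw [Finset.sum_insert N1, Finset.sum_insert N2, Finset.sum_insert N3,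
            Finset.sum_insert N4, Finset.sum_insert hq3U, hU]
          simp only [ha', hc']
          exact soloBlind_tri_close three τ (h q1) (h q2) (h q3) (0) (0) (0) (0) (by
            (try simp only [zero_smul, add_zero]); abel))).elim
  · have hU : ∑ i ∈ U, h i = τ - (h a + h q2 + h q3) := by rw [← hsplit]; abel
    have N1 : b ∉ insert c (insert q3 U) := by
      simp only [Finset.mem_insert, not_or]; exact ⟨d_b_c, d_b_q3, hbU⟩
    have N2 : c ∉ insert q3 U := by
      simp only [Finset.mem_insert, not_or]; exact ⟨d_c_q3, hcU⟩
    exact (hgood (insert b (insert c (insert q3 U))) (hins _ hb _ (hins _ hc _ (hins _ hq3 _ hUS)))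
      (by rw [Finset.sum_insert N1, Finset.sum_insert N2, Finset.sum_insert hq3U, hU]
          simp only [ha', hb', hc']
          exact soloBlind_tri_close three τ (h q1) (h q2) (h q3) (0) (0) (-1) (0) (by
            (try simp only [zero_smul, add_zero, zero_add]); abel))).elim
  · have hU : ∑ i ∈ U, h i = τ - (h a + h q2) := by rw [← hsplit]; abel
    have N1 : b ∉ insert c U := by
      simp only [Finset.mem_insert, not_or]; exact ⟨d_b_c, hbU⟩
    exact (hgood (insert b (insert c U)) (hins _ hb _ (hins _ hc _ hUS))
      (by rw [Finset.sum_insert N1, Finset.sum_insert hcU, hU]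
          simp only [ha', hb', hc']
          exact soloBlind_tri_close three τ (h q1) (h q2) (h q3) (0) (0) (-1) (0) (by
            (try simp only [zero_smul, add_zero, zero_add]); abel))).elim
  · have hU : ∑ i ∈ U, h i = τ - (h a + h q3) := by rw [← hsplit]; abel
    have N1 : a ∉ insert b (insert q1 (insert q2 (insert q3 U))) := by
      simp only [Finset.mem_insert, not_or]; exact ⟨d_a_b, d_a_q1, d_a_q2, d_a_q3, haU⟩
    have N2 : b ∉ insert q1 (insert q2 (insert q3 U)) := by
      simp only [Finset.mem_insert, not_or]; exact ⟨d_b_q1, d_b_q2, d_b_q3, hbU⟩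
    have N3 : q1 ∉ insert q2 (insert q3 U) := by
      simp only [Finset.mem_insert, not_or]; exact ⟨d_q1_q2, d_q1_q3, hq1U⟩
    have N4 : q2 ∉ insert q3 U := by
      simp only [Finset.mem_insert, not_or]; exact ⟨d_q2_q3, hq2U⟩
    exact (hgood (insert a (insert b (insert q1 (insert q2 (insert q3 U)))))
      (hins _ ha _ (hins _ hb _ (hins _ hq1 _ (hins _ hq2 _ (hins _ hq3 _ hUS)))))
      (by rw [Finset.sum_insert N1, Finset.sum_insert N2, Finset.sum_insert N3,
            Finset.sum_insert N4, Finset.sum_insert hq3U, hU]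
          simp only [ha', hb']
          exact soloBlind_tri_close three τ (h q1) (h q2) (h q3) (0) (0) (0) (0) (by
            (try simp only [zero_smul, add_zero]); abel))).elim
  · have hU : ∑ i ∈ U, h i = τ - (h a) := by rw [← hsplit]; abel
    have N1 : a ∉ insert b (insert q1 (insert q2 U)) := by
      simp only [Finset.mem_insert, not_or]; exact ⟨d_a_b, d_a_q1, d_a_q2, haU⟩
    have N2 : b ∉ insert q1 (insert q2 U) := by
      simp only [Finset.mem_insert, not_or]; exact ⟨d_b_q1, d_b_q2, hbU⟩
    have N3 : q1 ∉ insert q2 U := by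
      simp only [Finset.mem_insert, not_or]; exact ⟨d_q1_q2, hq1U⟩
    exact (hgood (insert a (insert b (insert q1 (insert q2 U))))
      (hins _ ha _ (hins _ hb _ (hins _ hq1 _ (hins _ hq2 _ hUS))))
      (by rw [Finset.sum_insert N1, Finset.sum_insert N2,
            Finset.sum_insert N3, Finset.sum_insert hq2U, hU]
          simp only [ha', hb']
          exact soloBlind_tri_close three τ (h q1) (h q2) (h q3) (0) (0) (0) (0) (by
            (try simp only [zero_smul, add_zero]); abel))).elim

end Summit.MatrixMultiplication.MatrixMultiplication.Theorems
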